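import Summits.MatrixMultiplication.MatrixMultiplication.Theorems.AbelianSTPPCensusThreeRoomEnergyJoint

/-!
# E3KJ on shape data: the joint Kneser minima `knLBc` / `knLBJ`, the predicate `E3kjAdm`, its soundness, evaluations (cell mm-stpp, theory g14)

Shape-level interface of rule E3KJ (`STPPThreeRoomEnergy.false_of_energy3kj`, file `AbelianSTPPCensusThreeRoomEnergyJoint`), in the format of the
E3K interface `AbelianSTPPCensusE3KShape` (`knLB` / `e3kLHS` / `E3kAdm` / `e3kAdm_of_isSTPP`):

* `knLBc M x yz S` — the ROOM-CAPPED Kneser minimum for a letter class: `min {2d⌈x/d⌉ − d : 0 < d ∣ M, d·yz + S ≤ M}` (J1 caps the period);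
* `knLBJ M xy z S` — the JOINT minimum for the pair class: over `0 < d ∣ M`, `(2⌈xy/d⌉ − 1)d` when `⌈xy/d⌉ ≥ 2`, else `d` if the quotient-room test
  `xy · knLB (M/d) z + S ≤ M` passes and `3d` if it fails (J2);
* `e3kjLHS`, `E3kjAdmAB`, `E3kjAdm` — the E3K normal form `e3kL` with these class sizes, per member with `2V > M`, three pair classes by letter rotation;
  both predicates evaluate by `decide` after `unfold` (no `Decidable` instances declared, as for `E3kAdm`);
* `e3kjAdmAB_of_isSTPP`, `e3kjAdm_of_isSTPP`, `e3kjSound` — SOUNDNESS: the shape data of every `IsSTPP` family with non-empty sets in a finite abelian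
  group of order `M` is `E3kjAdm M` (standard axioms; no named fact);
* evaluations on the quartet champions of the seat's search (`AbelianSTPPCensusQuartetWitnesses`): NOT admissible at 620 (T_E), 910 (T_D), 3 638 and
  3 720 (T_C) — smooth orders, where E3K's independent minima degenerate — admissible at 594 (T_E), 832 (T_D, by a margin of 264 in 262 144), 3 655 (T_C).
Exact Python twin `HOME/mm-stpp-theory/quartetwall/e3kj.py` (agrees with all seven evaluations).
WHAT THIS IS NOT: no census number, no existence claim, no `ω` statement; a refinement of E3K silent where E3K is silent below doubling.
-/

set_option linter.dupNamespace false -- `MatrixMultiplication.MatrixMultiplication` (summit = problem, D-0017)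
set_option autoImplicit false

namespace Summit.MatrixMultiplication.MatrixMultiplication.Theorems

namespace STPPThreeRoomEnergy

open Finset Literature.Computability.AlgebraicComplexity

/-! ## Shape level: the joint Kneser minima and the predicate `E3kjAdm` -/

/-- **Room-capped Kneser minimum for a letter**: `min (2x − 1, min {2d⌈x/d⌉ − d : 0 < d ∣ M, d·yz + S ≤ M})` — the least size of `X_t − X_t` that
Kneser allows once J1 has capped the period `d` of `X_t − X_t` by the room (`d·|Y_t||Z_t| + S_X ≤ M`). Right fold, evaluates by `decide`. [original] -/
def knLBc (M x yz S : ℕ) : ℕ :=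
  ((List.range (M + 1)).filter (fun d => decide (0 < d ∧ d ∣ M ∧ d * yz + S ≤ M))).foldr
    (fun d acc => min (2 * (d * ((x + d - 1) / d)) - d) acc) (2 * x - 1)

/-- **Joint Kneser minimum for the pair class** `Q = (X_t − Y_t) − (X_t − Y_t)` (`|X_t − Y_t| = xy`, third letter of size `z`, off-member sum `S`):
`min (2xy − 1, min_{0 < d ∣ M} f d)` with `f d = 2d⌈xy/d⌉ − d` if `⌈xy/d⌉ ≥ 2`, else (`xy ≤ d`, one-coset case possible) `f d = d` when the
quotient room test `xy · knLB (M/d) z + S ≤ M` passes and `f d = 3d` when it fails (then `X_t − Y_t` meets at least two cosets of the period, J2). [original] -/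
def knLBJ (M xy z S : ℕ) : ℕ :=
  ((List.range (M + 1)).filter (fun d => decide (0 < d ∧ d ∣ M))).foldr
    (fun d acc => min (if 2 ≤ (xy + d - 1) / d then 2 * (d * ((xy + d - 1) / d)) - d
      else if xy * knLB (M / d) z + S ≤ M then d else 3 * d) acc) (2 * xy - 1)

/-- `knLBc ≤ 2d⌈x/d⌉ − d` for every positive divisor `d` of a positive `M` that passes the cap. [bookkeeping] -/
theorem knLBc_le {M x yz S d : ℕ} (hM : 0 < M) (hd : 0 < d) (hdM : d ∣ M) (hcap : d * yz + S ≤ M) :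
    knLBc M x yz S ≤ 2 * (d * ((x + d - 1) / d)) - d := by
  unfold knLBc
  refine foldr_min_le (fun d => 2 * (d * ((x + d - 1) / d)) - d) _ _ ?_
  rw [List.mem_filter, List.mem_range]
  exact ⟨Nat.lt_succ_of_le (Nat.le_of_dvd hM hdM), by simp [hd, hdM, hcap]⟩

/-- `knLBJ ≤ f d` for every positive divisor `d` of a positive `M`. [bookkeeping] -/
theorem knLBJ_le {M xy z S d : ℕ} (hM : 0 < M) (hd : 0 < d) (hdM : d ∣ M) :
    knLBJ M xy z S ≤ (if 2 ≤ (xy + d - 1) / d then 2 * (d * ((xy + d - 1) / d)) - d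
      else if xy * knLB (M / d) z + S ≤ M then d else 3 * d) := by
  unfold knLBJ
  refine foldr_min_le (fun d => if 2 ≤ (xy + d - 1) / d then 2 * (d * ((xy + d - 1) / d)) - d
      else if xy * knLB (M / d) z + S ≤ M then d else 3 * d) _ _ ?_
  rw [List.mem_filter, List.mem_range]
  exact ⟨Nat.lt_succ_of_le (Nat.le_of_dvd hM hdM), by simp [hd, hdM]⟩

/-- The room-capped minimum is an admissible letter-class size for `false_of_energy3kj`. [bookkeeping] -/
theorem knLBc_pred_succ_add_le {M x yz S d : ℕ} (hM : 0 < M) (hx : 0 < x) (hd : d ∈ M.divisors) (hcap : d * yz + S ≤ M) :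
    (knLBc M x yz S - 1) + 1 + d ≤ 2 * (d * ((x + d - 1) / d)) := by
  obtain ⟨hdM, -⟩ := Nat.mem_divisors.1 hd
  have hdpos : 0 < d := Nat.pos_of_dvd_of_pos hdM hM
  have h1 := knLBc_le (x := x) hM hdpos hdM hcap
  have h2 : 1 ≤ (x + d - 1) / d := by
    rw [Nat.le_div_iff_mul_le hdpos]; omega
  have h3 : d ≤ d * ((x + d - 1) / d) := Nat.le_mul_of_pos_right d h2
  omega

/-- The joint minimum is an admissible pair-class size for `false_of_energy3kj`. [bookkeeping] -/
theorem knLBJ_add_le {M xy z S d : ℕ} (hM : 0 < M) (hxy : 0 < xy) (hd : d ∈ M.divisors) (m : ℕ) (hm : xy ≤ m * d)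
    (h1 : m = 1 → xy * knLB (M / d) z + S ≤ M) : knLBJ M xy z S + d ≤ 2 * (m * d) := by
  obtain ⟨hdM, -⟩ := Nat.mem_divisors.1 hd
  have hdpos : 0 < d := Nat.pos_of_dvd_of_pos hdM hM
  have hle := knLBJ_le (xy := xy) (z := z) (S := S) hM hdpos hdM
  have hmpos : 1 ≤ m := by
    rcases Nat.eq_zero_or_pos m with rfl | hm0
    · simp at hm; omega
    · exact hm0
  -- ⌈xy/d⌉ ≤ m
  have hceil : (xy + d - 1) / d ≤ m := by
    rw [Nat.div_le_iff_le_mul_add_pred hdpos]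
    have : xy + d - 1 ≤ m * d + (d - 1) := by omega
    simpa [mul_comm] using this
  by_cases h2 : 2 ≤ (xy + d - 1) / d
  · rw [if_pos h2] at hle
    have h3 : d * ((xy + d - 1) / d) ≤ d * m := Nat.mul_le_mul_left d hceil
    have h4 : d ≤ d * ((xy + d - 1) / d) := Nat.le_mul_of_pos_right d (by omega)
    have : 2 * (m * d) = 2 * (d * m) := by ring
    omega
  · rw [if_neg h2] at hle
    by_cases h3 : xy * knLB (M / d) z + S ≤ M
    · rw [if_pos h3] at hle
      have : 2 * (1 * d) ≤ 2 * (m * d) := Nat.mul_le_mul_left 2 (Nat.mul_le_mul_right d hmpos)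
      omega
    · rw [if_neg h3] at hle
      have hm2 : 2 ≤ m := by
        rcases Nat.lt_or_ge m 2 with hlt | hge
        · exfalso; have : m = 1 := by omega
          exact h3 (h1 this)
        · exact hge
      have : 2 * (2 * d) ≤ 2 * (m * d) := Nat.mul_le_mul_left 2 (Nat.mul_le_mul_right d hm2)
      omega

/-- **The E3KJ left-hand side of one member on shape data** (pair `(A,B)`): as `e3kLHS` with the room-capped letter classes
`knLBc M x (yz) S_A − 1`, `knLBc M y (zx) S_B − 1`, `knLBc M z (xy) S_C − 1` and the joint pair class `knLBJ M (xy) z S_C`. [original] -/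
def e3kjLHS (M x y z SA SB SC : ℕ) : ℕ :=
  e3kL M (x * y * z) (knLBc M x (y * z) SA - 1) (knLBc M y (z * x) SB - 1) (knLBc M z (x * y) SC - 1) (knLBJ M (x * y) z SC)
    (M - (x * y * z + SA)) (M - (x * y * z + SB)) (M - (x * y * z + SC))

/-- **E3KJ on a shape list, pair `(A,B)`**: every member `t` with `2V_t > M` has `e3kjLHS ≤ V_t²`. Sound for STPP families
(`e3kjAdmAB_of_isSTPP`). [original] -/
def E3kjAdmAB {N : ℕ} (M : ℕ) (a b c : Fin N → ℕ) : Prop :=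
  ∀ t : Fin N, M < 2 * (a t * b t * c t) →
    e3kjLHS M (a t) (b t) (c t) (∑ u ∈ univ.erase t, b u * c u) (∑ u ∈ univ.erase t, c u * a u)
      (∑ u ∈ univ.erase t, a u * b u) ≤ (a t * b t * c t) ^ 2

/-- **E3KJ on a shape list** (three pair classes via the letter rotations `(a,b,c)`, `(b,c,a)`, `(c,a,b)`). No claim by itself. [original] -/
def E3kjAdm {N : ℕ} (M : ℕ) (a b c : Fin N → ℕ) : Prop :=
  E3kjAdmAB M a b c ∧ E3kjAdmAB M b c a ∧ E3kjAdmAB M c a b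

/-- **E3KJ (pair `(A,B)`) holds on the shape data of every STPP family** with non-empty sets in a finite abelian group. [original] -/
theorem e3kjAdmAB_of_isSTPP {H : Type*} [AddCommGroup H] [Fintype H] [DecidableEq H] {N : ℕ} {A B C : Fin N → Finset H}
    (hS : IsSTPP A B C) (hne : ∀ i, (A i).Nonempty ∧ (B i).Nonempty ∧ (C i).Nonempty) :
    E3kjAdmAB (Fintype.card H) (fun i => (A i).card) (fun i => (B i).card) (fun i => (C i).card) := by
  intro t h2
  by_contra hlt
  have hpos : ∀ r, 0 < (A r).card ∧ 0 < (B r).card ∧ 0 < (C r).card :=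
    fun r => ⟨card_pos.2 (hne r).1, card_pos.2 (hne r).2.1, card_pos.2 (hne r).2.2⟩
  have hM : 0 < Fintype.card H := Fintype.card_pos
  exact false_of_energy3kj hS (a := fun i => (A i).card) (b := fun i => (B i).card) (c := fun i => (C i).card)
    (fun _ => rfl) (fun _ => rfl) (fun _ => rfl) hpos rfl t _ _ _ rfl rfl rfl
    (knLBc (Fintype.card H) (A t).card ((B t).card * (C t).card) (∑ u ∈ univ.erase t, (B u).card * (C u).card) - 1)
    (knLBc (Fintype.card H) (B t).card ((C t).card * (A t).card) (∑ u ∈ univ.erase t, (C u).card * (A u).card) - 1)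
    (knLBc (Fintype.card H) (C t).card ((A t).card * (B t).card) (∑ u ∈ univ.erase t, (A u).card * (B u).card) - 1)
    (knLBJ (Fintype.card H) ((A t).card * (B t).card) (C t).card (∑ u ∈ univ.erase t, (A u).card * (B u).card))
    (fun d hd hcap => knLBc_pred_succ_add_le hM (hpos t).1 hd hcap)
    (fun d hd hcap => knLBc_pred_succ_add_le hM (hpos t).2.1 hd hcap)
    (fun d hd hcap => knLBc_pred_succ_add_le hM (hpos t).2.2 hd hcap)
    (fun d hd m hm h1 => knLBJ_add_le hM (Nat.mul_pos (hpos t).1 (hpos t).2.1) hd m hm h1) h2 (not_le.mp hlt)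

/-- **E3KJ holds on the shape data of every STPP family** (all three pair classes, via `IsSTPP.rotate`). [original] -/
theorem e3kjAdm_of_isSTPP {H : Type*} [AddCommGroup H] [Fintype H] [DecidableEq H] {N : ℕ} {A B C : Fin N → Finset H}
    (hS : IsSTPP A B C) (hne : ∀ i, (A i).Nonempty ∧ (B i).Nonempty ∧ (C i).Nonempty) :
    E3kjAdm (Fintype.card H) (fun i => (A i).card) (fun i => (B i).card) (fun i => (C i).card) :=
  ⟨e3kjAdmAB_of_isSTPP hS hne,
    e3kjAdmAB_of_isSTPP hS.rotate fun i => ⟨(hne i).2.1, (hne i).2.2, (hne i).1⟩,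
    e3kjAdmAB_of_isSTPP hS.rotate.rotate fun i => ⟨(hne i).2.2, (hne i).1, (hne i).2.1⟩⟩

/-- **`E3KJSound`** in the census item format: every STPP family with non-empty sets in a finite abelian group `H` is `E3kjAdm |H|` at its
shape list.  Standard axioms; no named fact. [original] -/
theorem e3kjSound : ∀ (H : Type) [AddCommGroup H] [Fintype H] (N : ℕ) (A B C : Fin N → Finset H), IsSTPP A B C →
    (∀ i, (A i).Nonempty ∧ (B i).Nonempty ∧ (C i).Nonempty) →
      E3kjAdm (Fintype.card H) (fun i => (A i).card) (fun i => (B i).card) (fun i => (C i).card) := by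
  intro H _ _ N A B C h hne
  classical
  exact e3kjAdm_of_isSTPP h hne

/-! ## Evaluations on the quartet champions of the seat's search (cf. `AbelianSTPPCensusQuartetWitnesses`) -/

/-- T_E champion `(7,7,7)⁴ + (5,6,6)` at `594 = 2·3³·11` IS `E3kjAdm 594` (uniform cubes: every room comfortable, margin ≈ 30 %). [original] -/
theorem e3kjAdm_594 : E3kjAdm 594 (![7, 7, 7, 7, 5] : Fin 5 → ℕ) ![7, 7, 7, 7, 6] ![7, 7, 7, 7, 6] := by
  unfold E3kjAdm E3kjAdmAB
  decide +kernel

/-- T_E champion `(6,8,8)³ + (7,7,7) + (5,5,6)` at `620 = 2²·5·31` (quartet-, E3⁺-, E3K-admissible, beating) is NOT `E3kjAdm 620`: for a member `(6,8,8)`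
(`V = 384`, slacks `(29, 61, 66)`) J1 excludes the period `10` of `B_t − B_t`, `C_t − C_t` (`10·48 + 163 > 620`) and J2 lifts the pair classes `62 → 90`
(twin margin `87 → −1 792`). [original] -/
theorem not_e3kjAdm_620 : ¬ E3kjAdm 620 (![6, 6, 6, 7, 5] : Fin 5 → ℕ) ![8, 8, 8, 7, 5] ![8, 8, 8, 7, 6] := by
  unfold E3kjAdm E3kjAdmAB
  decide +kernel

/-- T_D champion `(8,8,8)⁴ + (7,8,8)` at `832 = 2⁶·13` IS `E3kjAdm 832`, by a hair (twin margin `2 568 → 264` on `(8,8,8)`). [original] -/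
theorem e3kjAdm_832 : E3kjAdm 832 (![8, 8, 8, 8, 7] : Fin 5 → ℕ) ![8, 8, 8, 8, 8] ![8, 8, 8, 8, 8] := by
  unfold E3kjAdm E3kjAdmAB
  decide +kernel

/-- T_D champion `(7,8,10)⁴ + (6,9,10)` at `910 = 2·5·7·13` is NOT `E3kjAdm 910` (member `(7,8,10)`: E3K margin `1 500`; J2 lifts the pair classes
`(65, 91, 70) → (91, 130, 105)`; twin margin `−1 908`). [original] -/
theorem not_e3kjAdm_910 : ¬ E3kjAdm 910 (![7, 7, 7, 7, 6] : Fin 5 → ℕ) ![8, 8, 8, 8, 9] ![10, 10, 10, 10, 10] := by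
  unfold E3kjAdm E3kjAdmAB
  decide +kernel

/-- T_C champion `(13,13,13)⁷ + (11,11,12)` at `3638 = 2·17·107` is NOT `E3kjAdm 3638` (member `(13,13,13)`: E3K margin `8 817`; J1 lifts the letter
classes `17 → 25` (period `17` excluded by the rooms), J2 the pair classes `214 → 306`; twin margin `−28 775`). [original] -/
theorem not_e3kjAdm_3638 : ¬ E3kjAdm 3638 (![13, 13, 13, 13, 13, 13, 13, 11] : Fin 8 → ℕ) ![13, 13, 13, 13, 13, 13, 13, 11]
    ![13, 13, 13, 13, 13, 13, 13, 12] := by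
  unfold E3kjAdm E3kjAdmAB
  decide +kernel

/-- T_C champion `(13,13,13)⁶ + (12,12,13)²` at `3655 = 5·17·43` IS `E3kjAdm 3655` (no degenerate period; «U11-hard»). [original] -/
theorem e3kjAdm_3655 : E3kjAdm 3655 (![13, 13, 13, 13, 13, 13, 12, 12] : Fin 8 → ℕ) ![13, 13, 13, 13, 13, 13, 12, 12]
    ![13, 13, 13, 13, 13, 13, 13, 13] := by
  unfold E3kjAdm E3kjAdmAB
  decide +kernel

/-- T_C champion `(10,15,15) + (13,13,13)⁵ + (12,13,13)²` at `3720 = 2³·3·5·31` is NOT `E3kjAdm 3720` (member `(10,15,15)`: E3K margin `2 660`,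
J2 lifts the pair classes `(155, 248, 155) → (248, 360, 248)`; twin margin `−29 484`). [original] -/
theorem not_e3kjAdm_3720 : ¬ E3kjAdm 3720 (![10, 13, 13, 13, 13, 13, 12, 12] : Fin 8 → ℕ) ![15, 13, 13, 13, 13, 13, 13, 13]
    ![15, 13, 13, 13, 13, 13, 13, 13] := by
  unfold E3kjAdm E3kjAdmAB
  decide +kernel

end STPPThreeRoomEnergy

end Summit.MatrixMultiplication.MatrixMultiplication.Theorems
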